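import Mathlib
import Summits.NavierStokesRegularity.NavierStokesRegularity.Theses.SubOnsagerCeiling
import Literature.Analysis.FluidPDE.Tao2016AveragedNS.ViscousEnvelopeSmoothing
import Literature.Analysis.FluidPDE.Tao2016AveragedNS.SelfSimilarCascadeBlowup
import HarnessLib

/-!
# `SubOnsagerCeiling.BreakOfCeiling` — a sub-Onsager tail ceiling plus cone invariance give
global pseudo-solutions for orthant tables (item stmt-NavierStokesRegularity-25509; glue with
content)

**Statement (verbatim route decl).** `OrthantTailCeiling → OrthantInvariance → ∀ R ≥ 1,
∀ ε₀ ∈ (0, 1], ∀ α ∈ E₂(R) orthant, ∀ X₀, ¬ NoGlobalCascade ε₀ α X₀`.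

PROOF (the item's plan = the tree's `Theorems.orthantBreakOfWake_proof` minus its
ratchet-to-envelope lemma). Fix `R ≥ 1`, `ε₀ ∈ (0, 1]`, an orthant table `α ∈ E₂(R)` and a datum
`X₀`, and suppose `NoGlobalCascade ε₀ α X₀`; by the κ-normal form (`noGlobalCascade_iff_kappa`)
some defect level `κ > 0` carries no global pseudo-solution. `OrthantTailCeiling` gives `θ > 1/2`
and `C ≥ 0` with the tail ceiling `Σ_{k=n..N} Σ_i ½X_{i,k}(t)² ≤ C·E₀·(1+ε₀)^{−2θn}` for every
honest `ν`-viscous solution that is non-negative on shells `≥ 1`; cone invariance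
(`OrthantInvariance`) supplies that sign for every honest viscous solution of an orthant table.
With `η := 2θ − 1 > 0` this is exactly the subcritical envelope `C·E₀·(1+ε₀)^{−(1+η)n}` of the
tree's smoothing theorem `exists_viscousGlobal_of_subcriticalEnvelope_of_inTableClass` at
viscosity `ν = κ/√2`, which yields a global regular viscous solution, hence a global
`(κ, κ)`-pseudo-solution (`hasGlobal_of_viscousGlobal`, `hasGlobal_mono`) — contradiction.

HONEST FRAMING: statements about Tao-type MODEL lattice ODEs (route SubOnsagerCeiling, rung
TL-M2Break); `OrthantTailCeiling` is the route's OPEN (XL) crux and stays a hypothesis; nothing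
here bears on Navier–Stokes regularity and no summit is proved.
-/

noncomputable section

-- the sub-problem namespace `NavierStokesRegularity.NavierStokesRegularity` is the tree's layout (D-0017)
set_option linter.dupNamespace false

namespace Summit.NavierStokesRegularity.NavierStokesRegularity.Theorems

open Set Filter
open scoped Topology
open Literature.Analysis.FluidPDE.TaoCascade

/-- **Item stmt-NavierStokesRegularity-25509** (`SubOnsagerCeiling.BreakOfCeiling`): a
`θ > 1/2` weighted tail ceiling for the non-negative honest viscous solutions of an orthant table
(`OrthantTailCeiling`) and Kamke cone invariance (`OrthantInvariance`) imply, for every `R ≥ 1`,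
every scale ratio `1 + ε₀ ∈ (1, 2]` and every orthant table of `E₂(R)`, the negation of
`NoGlobalCascade` from every one-shell datum (subcritical-envelope smoothing at `η = 2θ − 1`).
MODEL lattice statement; no Navier–Stokes statement is proved. [this file] -/
theorem subOnsagerCeiling_breakOfCeiling_proof :
    Summit.NavierStokesRegularity.NavierStokesRegularity.Theses.SubOnsagerCeiling.BreakOfCeiling := by
  unfold Summit.NavierStokesRegularity.NavierStokesRegularity.Theses.SubOnsagerCeiling.BreakOfCeiling
    Summit.NavierStokesRegularity.NavierStokesRegularity.Theses.SubOnsagerCeiling.OrthantTailCeiling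
    Summit.NavierStokesRegularity.NavierStokesRegularity.Theses.SubOnsagerCeiling.OrthantInvariance
  intro hC hI R hR ε₀ hε₀ hε1 α X₀ hα hK hNG
  obtain ⟨κ, hκ, hno⟩ := (noGlobalCascade_iff_kappa hε₀).1 hNG
  have h2 : 0 < Real.sqrt 2 := Real.sqrt_pos.2 two_pos
  have hν : 0 < κ / Real.sqrt 2 := div_pos hκ h2
  -- the tail ceiling of the orthant table `α` at scale ratio `1 + ε₀`
  obtain ⟨θ, hθ, C, _hC0, H⟩ := hC R hR ε₀ hε₀ hε1 α hα hK
  -- the subcritical envelope exponent `η = 2θ - 1 > 0`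
  have hη : 0 < 2 * θ - 1 := by linarith
  obtain ⟨X, hX⟩ := exists_viscousGlobal_of_subcriticalEnvelope_of_inTableClass hε₀.le hη hν hα X₀
    (fun T _hT => ⟨C * (∑ i : Fin 4, (1 / 2 : ℝ) * X₀ i ^ 2),
      fun s hs Y hinit hlow hbd hcont hder n N hnN t ht => by
        have hnonneg := hI ε₀ (κ / Real.sqrt 2) hε₀ hν α hK X₀ s hs.1 Y hinit hlow hbd hcont hder
        have hceil := H (κ / Real.sqrt 2) hν X₀ s hs.1 Y hinit hlow hbd hcont hder hnonneg n N hnN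
          t ht
        have hexp : -((1 + (2 * θ - 1)) * (n : ℝ)) = -(2 * θ * (n : ℝ)) := by ring
        rw [hexp]
        exact hceil⟩)
  have hG := hasGlobal_of_viscousGlobal hε₀ hν.le hX
  rw [div_mul_cancel₀ κ h2.ne'] at hG
  exact hno (hasGlobal_mono hε₀.le hG le_rfl hκ.le)

end Summit.NavierStokesRegularity.NavierStokesRegularity.Theorems

end
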